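import Mathlib

/-!
# `PolycrystalWulffBound`: ordered-pair sums of a symmetric kernel (re-indexing clause (B)'s double sum)

Route `StickyWulffConstant` of the venture `Summits/Ventures/Crystal3D`, crux `PolycrystalWulffBound`
(item `stmt-Ventures-19482`), second prover lane.  Clause (B) of `PolytopeCalculus` subtracts
`Σ_i Σ_j (if i < j then T i j else 0)` for a kernel `T` which — with antisymmetric normals
(`exists_disjoint_polytope_refinement_full`) and `crossTerm_neg` — is SYMMETRIC, `T i j = T j i`.
For symmetric kernels the `i < j` sum is half the `i ≠ j` sum, and the latter is invariant under any
re-indexing `e : Fin m ≃ {j // j ∈ s}` of a sub-family of cells; these two bookkeeping identities are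
what step 4 of the P-BRIDGE memo (interface of two polyhedral grains = cross-cell facet sum) needs.

* the half-sum identity `Σ_{i<j} T = ½ Σ_{i≠j} T` for symmetric `T` on `Fin n` is ALREADY in the tree:
  `Literature.Dynamics.NBody.sum_lt_eq_half_sum_ne` (Literature/Dynamics/NBody/JensenLeykin2025S3Dictionary.lean) —
  import it there, it is not restated here;
* `sum_sum_ite_ne_equiv` — `Σ_i Σ_i' [i ≠ i'] T (e i) (e i') = Σ_{a ∈ s} Σ_{b ∈ s} [a ≠ b] T a b`
  for `e : Fin m ≃ {j // j ∈ s}`.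
WHAT THIS IS NOT: anything geometric.
-/

namespace Summit.Ventures.Crystal3D.Theorems

open Finset

/-- Re-indexing invariance of the `i ≠ j` double sum along an enumeration `e : Fin m ≃ s` of a
sub-family `s ⊆ Fin k`. -/
theorem sum_sum_ite_ne_equiv {k m : ℕ} (T : Fin k → Fin k → ℝ) (s : Finset (Fin k))
    (e : Fin m ≃ {j // j ∈ s}) :
    (∑ i, ∑ i', if i ≠ i' then T (e i).1 (e i').1 else 0) =
      ∑ a ∈ s, ∑ b ∈ s, if a ≠ b then T a b else 0 := by
  -- pass to sums over the subtype `{j // j ∈ s}`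
  have h1 : (∑ i, ∑ i', if i ≠ i' then T (e i).1 (e i').1 else 0) =
      ∑ a : {j // j ∈ s}, ∑ b : {j // j ∈ s}, if a ≠ b then T a.1 b.1 else 0 := by
    rw [← e.sum_comp]
    refine Finset.sum_congr rfl fun i _ => ?_
    rw [← e.sum_comp]
    refine Finset.sum_congr rfl fun i' _ => ?_
    by_cases h : i = i'
    · subst h; simp
    · have h' : e i ≠ e i' := e.injective.ne h
      rw [if_pos h, if_pos h']
  rw [h1]
  have h2 : ∀ a : {j // j ∈ s}, (∑ b : {j // j ∈ s}, if a ≠ b then T a.1 b.1 else 0) =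
      ∑ b ∈ s, if a.1 ≠ b then T a.1 b else 0 := by
    intro a
    rw [← Finset.sum_coe_sort s]
    refine Finset.sum_congr rfl fun b _ => ?_
    by_cases h : a = b
    · subst h; simp
    · have h' : a.1 ≠ b.1 := fun hh => h (Subtype.ext hh)
      rw [if_pos h, if_pos h']
  simp_rw [h2]
  rw [← Finset.sum_coe_sort s]

end Summit.Ventures.Crystal3D.Theorems
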